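import Summits.BirchSwinnertonDyer.BirchSwinnertonDyer.Theorems.PrintCf2RamifiedOffTYZSquareSilenceTwoPrimesEven
import Summits.BirchSwinnertonDyer.BirchSwinnertonDyer.Theorems.PrintCf2RamifiedOffTYZLowerHalfDoorEven
import Summits.BirchSwinnertonDyer.BirchSwinnertonDyer.Theorems.PrintCf2RamifiedOffTYZHalfMover
import HarnessLib

/-!
# Crux `PrintCf2.RamifiedOffTYZOfFacts` (stmt-BirchSwinnertonDyer-20509), line `offtyz-v7`, LEAD cycle 13 (cruxlead-20509 g12):
# THE LOWER HALF OF C⁺ ON THE EVEN TWO-PRIME JUMP-ONE CLASS — on `n = 2lq` with `#Sel₂(E_n) = 2⁵`, `r_an = 1` and a generator outside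
# `⟨−1, 2, n⟩·ℚ^{×2}`, the Tian–Yuan–Zhang integer `𝓛(n)` is EVEN; and C⁺ at `n` is ONE Galois bit

THEOREMS ONLY (no `def`, no named fact, no `sorry`), `--supports stmt-BirchSwinnertonDyer-20509` (item 23431 `RamifiedJumpOneLevelTwoOfFacts` = C⁺, its
even sectors E1 `n = 2lq, q ≡ 3 (8)` / E2 `q ≡ 7 (8)`).  Sequel of `…SquareSilenceTwoPrimesEven` (p732749: `g²·P(n) = P(n)` for every `g` on this class)
and the even companion of g11's `…HalfMover` / `…LowerHalfDoor` (odd `n` only).  HONEST FRAMING: bookkeeping on the displayed statements (Thm 3.5 main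
clause, Lemma 3.18, the recursion, the CM-point layer), Thm 1.1 (as `𝓛(l)` even), GZK, the Frobenius clause (F1)–(F3) of `𝔭_l` with the ONE extra printed
sentence (F5) «`φ_l ∉ Gal(ℍ′_n/H_n)`» (explicit hypothesis, pending its display), and Galois theory on `ℍ′_n`.  Nothing is asserted; C⁺ stays open.

* §1 `exists_algEquiv_apply_eq_neg_of_sq_eq_even`: a square root `w ∈ ℍ′_n` of `ξ ∈ ℚ` with `ξ, −2ξ ∉ {±1, ±n}·ℚ^{×2}` is negated by some automorphism
  fixing `i`, `√−2`, `√−n` (g11's three-character lemma applied to `w` and to `w√−2`, composing when both movers flip `√−2`).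
* §2 `exists_halfMover_even_of_x_not_mem`: for `R = (x, y) ∈ E_n(ℚ)`, `x ∉ {±1, ±2, ±n, ±2n}·ℚ^{×2}`, and a half `Q₁` of its twist, some `g₀` fixing
  `i`, `√−2`, `√−n` MOVES `Q₁` (`(Y₁/X₁)² = −4x/n`).
* §3 **`two_dvd_scriptL_two_primes_even_of_halfMover`** (Galois form), **`levelTwo_iff_galPt_genusPoint_ne_two_primes_even_of_halfMover`** (C⁺ at `n`
  ⟺ `g₀·P(n) ≠ P(n)`), and **`two_dvd_scriptL_two_primes_even_of_x_not_mem`**: `n = 2lq` square-free, `l ≡ 1 (mod 8)`, `q ≡ 3 (mod 4)`, `(l/q) = 1`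
  [⟺ `#Sel₂(E_n) = 2⁵` on `n = 2lq ≡ 6 (8)`], `ord_{s=1} L(E_n, s) = 1`, GZK, displays, `𝓛(l)` even, (F1)–(F3)+(F5) for `𝔭_l`, and a generator
  `R = (x, y)` of `E_n(ℚ)` mod torsion with `x ∉ {±1, ±2, ±n, ±2n}·ℚ^{×2}` ⟹ **`2 ∣ L` for every `L` with `𝓛(n)² = L²`** (g11's even door p729925,
  its square hypothesis discharged by the silence theorem).

What this buys the line: the LOWER HALF of C⁺ (the Ш-side direction «Selmer excess ⟹ analytic Ш even» that BSD₂ demands at `s = 3` and that TYZ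
Thm 1.2 does not state) on (E1 ∪ E2) ∩ {`x(R) ∉ ⟨−1,2,n⟩ℚ^{×2}`}, modulo displays + (F5); the UPPER half there is the bit `c_P(g₀)` (BSD₂: set).  Beyond-
print theorem: YES (conditional on the displayed statements and (F5)).  BSD is not proved by any of this; no class is closed by this file.

References: [cite: TianYuanZhang2017, §1 (p0002 L101–L110), Thm. 3.5 (p0011 L94–L100), §3.1 (p0011 L1–L73), Prop. 3.2 (2), Thm. 3.6 (2), Lemma 3.18,
proof of Lemma 3.21 (p0020 L27–L63), Thm. 1.1]; [cite: Cox2013, §5.C Lemma 5.19, (5.22), Cor. 5.21, §6.A Thm. 6.1, §9.A]; [cite: SilvermanAEC2009, X.4.9];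
[cite: Darmon2004, Thm. 3.22]; tree: g11 `…SignCharacters`, `…HalfMover`, `…LowerHalfDoorEven`; g12 `…SquareSilenceTwoPrimesEven`.
-/

noncomputable section

open scoped Classical

open WeierstrassCurve WeierstrassCurve.Affine Finset Literature.NumberTheory.EllipticCurves
  Literature.NumberTheory.EllipticCurves.Rank1Residual Summit.BirchSwinnertonDyer.Rank1Residual
  Literature.NumberTheory.EllipticCurves.TianYuanZhang2017
  Literature.NumberTheory.EllipticCurves.TianYuanZhang2017.W2
  Summit.BirchSwinnertonDyer.Rank1Residual.P2.GenusPeriodTransferLayer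
  Summit.BirchSwinnertonDyer.Rank1Residual.P2.ThetaDescent
  Summit.BirchSwinnertonDyer.Rank1Residual.P2
  Summit.BirchSwinnertonDyer.PrintCf2.MoverAssembly
  Summit.BirchSwinnertonDyer.PrintCf2.SignCharacters
  Summit.BirchSwinnertonDyer.PrintCf2.LevelTwoHalfGenerator
  Summit.BirchSwinnertonDyer.PrintCf2.LowerHalfDoorEven
  Summit.BirchSwinnertonDyer.PrintCf2.SquareSilenceEven

set_option autoImplicit false

namespace Summit.BirchSwinnertonDyer.PrintCf2.LowerHalfTwoPrimesEven

variable {n : ℕ}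

/-! ## §1 Galois: a square root of `ξ ∉ ⟨−1, 2, n⟩·ℚ^{×2}` is negated by some `g` fixing `i`, `√−2`, `√−n` -/

/-- **A square root `w ∈ ℍ′_n` of a rational `ξ` with `ξ, −2ξ ∉ {1, −1, n, −n}·ℚ^{×2}` is negated by some automorphism fixing `i`, `√−2` and
`√−n`** (`2 ∣ n`): two applications of the three-character lemma of `…SignCharacters` (to `w` and to `w·√−2`), composing the two automorphisms
when each moves `√−2`. [folklore] [cite: Cox2013, §6.A Thm. 6.1] -/
theorem exists_algEquiv_apply_eq_neg_of_sq_eq_even (D : GenusPointData n) (hn : n ∈ n.divisors) (h2 : 2 ∈ n.divisors) {w : D.H} {ξ : ℚ}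
    (hw : w ^ 2 = algebraMap ℚ D.H ξ)
    (hξ : ¬ ∃ q : ℚ, ξ = q ^ 2 ∨ ξ = -q ^ 2 ∨ ξ = n * q ^ 2 ∨ ξ = -(n * q ^ 2))
    (hξ2 : ¬ ∃ q : ℚ, -2 * ξ = q ^ 2 ∨ -2 * ξ = -q ^ 2 ∨ -2 * ξ = n * q ^ 2 ∨ -2 * ξ = -(n * q ^ 2)) :
    ∃ g : D.H ≃ₐ[ℚ] D.H, g D.im = D.im ∧ g (D.sqrtNeg 2) = D.sqrtNeg 2 ∧ g (D.sqrtNeg n) = D.sqrtNeg n ∧ g w = -w := by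
  obtain ⟨g₁, h1i, h1n, h1w⟩ := exists_algEquiv_apply_eq_neg_of_sq_eq D hn hw hξ
  rcases apply_sqrtNeg_eq_or D g₁ h2 with h12 | h12
  · exact ⟨g₁, h1i, h12, h1n, h1w⟩
  -- `g₁` flips `√−2`: use `w' = w·√−2`, `w'² = −2ξ`
  have hw' : (w * D.sqrtNeg 2) ^ 2 = algebraMap ℚ D.H (-2 * ξ) := by
    rw [mul_pow, hw, D.sqrtNeg_sq 2 h2, map_mul, map_neg, map_ofNat]; push_cast; ring
  obtain ⟨g₂, h2i, h2n, h2w⟩ := exists_algEquiv_apply_eq_neg_of_sq_eq D hn hw' hξ2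
  rcases apply_sqrtNeg_eq_or D g₂ h2 with h22 | h22
  · -- `g₂` fixes `√−2`, hence negates `w`
    refine ⟨g₂, h2i, h22, h2n, ?_⟩
    have e : g₂ w * D.sqrtNeg 2 = -w * D.sqrtNeg 2 := by rw [← h22, ← map_mul, h2w, h22]; ring
    exact mul_right_cancel₀ (D.sqrtNeg_ne_zero h2) e
  · -- both flip `√−2`: `g₂` fixes `w`, and `g₁ g₂` works
    have hg2w : g₂ w = w := by
      have e : g₂ w * (-D.sqrtNeg 2) = w * (-D.sqrtNeg 2) := by
        have h := h2w
        rw [map_mul, h22] at h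
        linear_combination h
      exact mul_right_cancel₀ (neg_ne_zero.mpr (D.sqrtNeg_ne_zero h2)) e
    refine ⟨g₁ * g₂, ?_, ?_, ?_, ?_⟩
    · rw [AlgEquiv.mul_apply, h2i, h1i]
    · rw [AlgEquiv.mul_apply, h22, map_neg, h12, neg_neg]
    · rw [AlgEquiv.mul_apply, h2n, h1n]
    · rw [AlgEquiv.mul_apply, hg2w, h1w]

/-! ## §2 The even half-mover: `x(R) ∉ {±1, ±2, ±n, ±2n}·ℚ^{×2}` gives `g ∈ Gal(ℍ′_n/K_n(i, √2))` moving the half `Q₁` -/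

/-- **An even HALF-MOVER exists**: for `R = (x, y) ∈ E_n(ℚ)` (`2 ∣ n`) with `x ∉ {±1, ±2, ±n, ±2n}·ℚ^{×2}` and any half `Q₁` of its twist
(`φ_H(Q₁) = ι Θ_E(R)`), some automorphism of `ℍ′_n` fixing `i`, `√−2`, `√−n` has `g·Q₁ ≠ Q₁` (`Q₁ = (X₁, Y₁)`, `(Y₁/X₁)² = −4x/n`; negate `Y₁/X₁`).
The even companion of g11's `HalfMover.exists_halfMover_of_x_not_mem`. [cite: TianYuanZhang2017, §1 (p0002 L101–L110), §3.1 (p0011 L27–L64)] [cite: SilvermanAEC2009, X.4.9] -/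
theorem exists_halfMover_even_of_x_not_mem (hsq : Squarefree n) [(congruentNumberCurve n).IsElliptic] (heven : 2 ∣ n) (D : GenusPointData n)
    {x y : ℚ} (h : (congruentNumberCurve n).toAffine.Nonsingular x y)
    (hx : ¬ ∃ q : ℚ, x = q ^ 2 ∨ x = -q ^ 2 ∨ x = n * q ^ 2 ∨ x = -(n * q ^ 2))
    (hx2 : ¬ ∃ q : ℚ, x = 2 * q ^ 2 ∨ x = -(2 * q ^ 2) ∨ x = 2 * n * q ^ 2 ∨ x = -(2 * n * q ^ 2))
    {Q₁ : APoint D.H} (hQ₁ : φH D Q₁ = Point.map (W' := curveA.twoIsogenyCodomain)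
      (D.embK n (Nat.mem_divisors_self n hsq.ne_zero)) (ΘE hsq.ne_zero (.some x y h))) :
    ∃ g : D.H ≃ₐ[ℚ] D.H, g D.im = D.im ∧ g (D.sqrtNeg 2) = D.sqrtNeg 2 ∧ g (D.sqrtNeg n) = D.sqrtNeg n ∧ D.galPt g Q₁ ≠ Q₁ := by
  have hn0 : n ≠ 0 := hsq.ne_zero
  have hn : n ∈ n.divisors := Nat.mem_divisors_self n hn0
  have h2 : 2 ∈ n.divisors := Nat.mem_divisors.mpr ⟨heven, hn0⟩
  have hnQ : (n : ℚ) ≠ 0 := by exact_mod_cast hn0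
  obtain ⟨h₃, e₃⟩ := ΘE_some hn0 h
  have hθ : D.embK n hn (θn n) = D.sqrtNeg n := AdjoinRoot.liftAlgHom_root _ _ _ _
  have hs : D.sqrtNeg n ^ 2 = -(n : D.H) := D.sqrtNeg_sq n hn
  rcases Q₁ with _ | ⟨X₁, Y₁, hQ⟩
  · exfalso
    rw [← Point.zero_def, map_zero, e₃, Point.map_some] at hQ₁
    exact Point.some_ne_zero _ hQ₁.symm
  have hX0 : X₁ ≠ 0 := by
    intro hX
    have : φH D (.some X₁ Y₁ hQ) = 0 := twoIsogenyPointsHom_some_of_eq_zero curveA hQ hX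
    rw [this, e₃, Point.map_some] at hQ₁
    exact Point.some_ne_zero _ hQ₁.symm
  obtain ⟨h', eφ⟩ := twoIsogenyPointsHom_some curveA hQ hX0
  have hX : (curveA.baseChange D.H).twoIsogenyX X₁ = D.embK n hn ((θn n ^ 2)⁻¹ * algebraMap ℚ (GenusField n) (4 * x)) := by
    have := hQ₁
    rw [show φH D (.some X₁ Y₁ hQ) = curveA.twoIsogenyPointsHom D.H (.some X₁ Y₁ hQ) from rfl, eφ, e₃, Point.map_some,
      Point.some.injEq] at this
    exact this.1
  obtain ⟨-, h2', -, h4, -⟩ := curveA_baseChange_a (H := D.H)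
  have heq : Y₁ ^ 2 = X₁ ^ 3 + 4 * X₁ := (curveA_nonsingular_iff X₁ Y₁).mp hQ
  set w : D.H := Y₁ / X₁ with hw
  have hw2 : w ^ 2 = algebraMap ℚ D.H (-(4 * x) / n) := by
    have e1 : w ^ 2 = (curveA.baseChange D.H).twoIsogenyX X₁ := by
      rw [twoIsogenyX, h2', h4, hw, div_pow, div_eq_div_iff (pow_ne_zero 2 hX0) hX0]
      linear_combination X₁ * heq
    rw [e1, hX, map_mul, map_inv₀, map_pow, hθ, AlgHom.commutes, hs, map_div₀, map_neg, map_natCast]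
    field_simp
  have hξ : ¬ ∃ q : ℚ, -(4 * x) / n = q ^ 2 ∨ -(4 * x) / n = -q ^ 2 ∨ -(4 * x) / n = n * q ^ 2 ∨ -(4 * x) / n = -(n * q ^ 2) := by
    rintro ⟨q, hq | hq | hq | hq⟩ <;> apply hx <;> have hq' := (div_eq_iff hnQ).mp hq
    · exact ⟨q / 2, Or.inr (Or.inr (Or.inr (by linear_combination (-1 / 4 : ℚ) * hq')))⟩
    · exact ⟨q / 2, Or.inr (Or.inr (Or.inl (by linear_combination (-1 / 4 : ℚ) * hq')))⟩
    · exact ⟨n * q / 2, Or.inr (Or.inl (by linear_combination (-1 / 4 : ℚ) * hq'))⟩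
    · exact ⟨n * q / 2, Or.inl (by linear_combination (-1 / 4 : ℚ) * hq')⟩
  have hξ2 : ¬ ∃ q : ℚ, -2 * (-(4 * x) / n) = q ^ 2 ∨ -2 * (-(4 * x) / n) = -q ^ 2 ∨ -2 * (-(4 * x) / n) = n * q ^ 2 ∨
      -2 * (-(4 * x) / n) = -(n * q ^ 2) := by
    have e8 : -2 * (-(4 * x) / n) = 8 * x / n := by ring
    rw [e8]
    rintro ⟨q, hq | hq | hq | hq⟩ <;> apply hx2 <;> have hq' := (div_eq_iff hnQ).mp hq
    · exact ⟨q / 4, Or.inr (Or.inr (Or.inl (by linear_combination (1 / 8 : ℚ) * hq')))⟩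
    · exact ⟨q / 4, Or.inr (Or.inr (Or.inr (by linear_combination (1 / 8 : ℚ) * hq')))⟩
    · exact ⟨n * q / 4, Or.inl (by linear_combination (1 / 8 : ℚ) * hq')⟩
    · exact ⟨n * q / 4, Or.inr (Or.inl (by linear_combination (1 / 8 : ℚ) * hq'))⟩
  obtain ⟨g, hgi, hg2, hgK, hgw⟩ := exists_algEquiv_apply_eq_neg_of_sq_eq_even D hn h2 hw2 hξ hξ2
  refine ⟨g, hgi, hg2, hgK, fun hfix => ?_⟩
  rw [GenusPointData.galPt, Point.map_some, Point.some.injEq] at hfix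
  obtain ⟨h1, h2''⟩ := hfix
  have h1' : g X₁ = X₁ := h1
  have h2''' : g Y₁ = Y₁ := h2''
  have hgw' : g w = w := by rw [hw, map_div₀, h1', h2''']
  have hw0 : w ≠ 0 := by
    intro h0
    rw [h0, zero_pow two_ne_zero, eq_comm, map_eq_zero, div_eq_zero_iff] at hw2
    rcases hw2 with h0' | h0'
    · apply hx; exact ⟨0, Or.inl (by linear_combination (-1 / 4 : ℚ) * h0')⟩
    · exact hnQ h0'
  rw [hgw'] at hgw
  exact hw0 (eq_zero_of_eq_neg' hgw)

/-! ## §3 THE LOWER HALF of C⁺ on the even two-prime jump-one class -/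

/-- **SILENCE + HALF-MOVER ⟹ `2 ∣ 𝓛(n)` on `n = 2lq`** (Galois form).  `n = 2lq` square-free, `l ≡ 1 (mod 8)`, `q ≡ 3 (mod 4)`, `(l/q) = 1`;
`ord_{s=1} L(E_n, s) = 1`, GZK; the displayed recursion / Thm 3.5 main clause / sign choices / Lemma 3.18 / CM-point layer on every block;
`𝓛(l)` even (Thm 1.1); the Frobenius clause of `𝔭_l` with (F5); `R` a generator of `E_n(ℚ)` modulo torsion, `Q₁` a half of its twist, and a
HALF-MOVER `g₀` fixing `i`, `√−2`, `√−n`.  Then `2 ∣ L` for every `L` with `𝓛(n)² = L²` (the even door p729925 with its square hypothesis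
DISCHARGED by `galPt_sq_genusPoint_eq_two_primes_even`).
[cite: TianYuanZhang2017, Thm. 3.5 (p0011 L94–L100), Lemma 3.18, §3.1 (p0011 L1–L73), Prop. 3.2 (2), Thm. 3.6 (2), proof of Lemma 3.21 (p0020 L27–L63), Thm. 1.1]
[cite: Cox2013, §5.C Lemma 5.19, (5.22), Cor. 5.21, §9.A] [cite: Darmon2004, Thm. 3.22] -/
theorem two_dvd_scriptL_two_primes_even_of_halfMover
    (hGZK : rank_eq_analyticRank_of_analyticRank_le_one) (hsq : Squarefree n) {l q : ℕ} (hl : l.Prime) (hq : q.Prime)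
    (hlq : l ≠ q) (hn : n = 2 * l * q) (hl8 : l % 8 = 1) (hq4 : q % 4 = 3) (hleg : jacobiSym l q = 1)
    (hr : (congruentNumberCurve n).analyticRank = 1)
    (D : GenusPointData n) (hrec : D.recursion) (h35 : D.thm35Main) (hLs : D.scriptLSpec) (h318 : D.lemma318)
    (z : ℕ → APoint D.H) (Φ : ℕ → Finset (D.H ≃ₐ[ℚ] D.H)) (ΓH ΓH' : ℕ → Subgroup (D.H ≃ₐ[ℚ] D.H))
    (σ : ℕ → (D.H ≃ₐ[ℚ] D.H)) (c : D.H ≃ₐ[ℚ] D.H) (hc : D.ConjSpec c)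
    (hblock : ∀ d ∈ n.divisors, ((d % 8 = 5 ∨ d % 8 = 6) → D.CMBlockSpec d (z d) (Φ d) (ΓH d) (ΓH' d) (σ d) c) ∧
      (d % 8 = 7 → D.SevenBlockSpec d))
    (hLl : Even (D.scriptL l))
    (hFrobl : ∃ φ : D.H ≃ₐ[ℚ] D.H, φ (D.sqrtNeg n) = D.sqrtNeg n ∧ φ * φ ∈ ΓH' n ∧ φ D.im = (jacobiSym (-1) l) • D.im ∧
      (∀ r : ℕ, r.Prime → r ∣ n → r ≠ l → φ (D.sqrtNeg r) = (jacobiSym (-(r : ℤ)) l) • D.sqrtNeg r) ∧ φ ∉ ΓH n)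
    {R : (congruentNumberCurve n).toAffine.Point}
    (hR : haveI := isElliptic_congruentNumberCurve hsq.ne_zero; ∀ P, ∃ k : ℤ, IsOfFinAddOrder (P - k • R))
    {Q₁ : APoint D.H} (hQ₁ : φH D Q₁ = Point.map (W' := curveA.twoIsogenyCodomain)
      (D.embK n (Nat.mem_divisors_self n hsq.ne_zero)) (ΘE hsq.ne_zero R))
    (g₀ : D.H ≃ₐ[ℚ] D.H) (hgi : g₀ D.im = D.im) (hg2 : g₀ (D.sqrtNeg 2) = D.sqrtNeg 2) (hgK : g₀ (D.sqrtNeg n) = D.sqrtNeg n)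
    (hmoveQ : D.galPt g₀ Q₁ ≠ Q₁) :
    ∀ L : ℤ, IsScriptL n L → (2 : ℤ) ∣ L := by
  haveI := isElliptic_congruentNumberCurve hsq.ne_zero
  have h6 : n % 8 = 6 := by
    rw [hn, mul_assoc, Nat.mul_mod, show (l * q) % 8 = q % 8 by rw [Nat.mul_mod, hl8, one_mul, Nat.mod_mod]]; omega
  have hsq0 := galPt_sq_genusPoint_eq_two_primes_even D hsq hl hq hlq hn hl8 hq4 hleg hrec z Φ ΓH ΓH' σ c hc hblock hLl hFrobl g₀
  exact two_dvd_scriptL_of_halfMover_of_sq_eq_even hGZK hsq h6 hr D h35 hLs h318 hR hQ₁ g₀ hgi hg2 hgK hmoveQ hsq0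

/-- **C⁺ AS ONE GALOIS BIT on `n = 2lq`** (same data): the conclusion of C⁺ at `n` (`2 ∣ L ∧ 4 ∤ L` for every sign choice) holds iff the
half-mover `g₀` moves the genus point: `g₀·P(n) ≠ P(n)`. [cite: TianYuanZhang2017, Thm. 3.5 (p0011 L94–L100), Lemma 3.18, §3.1, Thm. 1.1] [cite: Darmon2004, Thm. 3.22] -/
theorem levelTwo_iff_galPt_genusPoint_ne_two_primes_even_of_halfMover
    (hGZK : rank_eq_analyticRank_of_analyticRank_le_one) (hsq : Squarefree n) {l q : ℕ} (hl : l.Prime) (hq : q.Prime)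
    (hlq : l ≠ q) (hn : n = 2 * l * q) (hl8 : l % 8 = 1) (hq4 : q % 4 = 3) (hleg : jacobiSym l q = 1)
    (hr : (congruentNumberCurve n).analyticRank = 1)
    (D : GenusPointData n) (hrec : D.recursion) (h35 : D.thm35Main) (hLs : D.scriptLSpec) (h318 : D.lemma318)
    (z : ℕ → APoint D.H) (Φ : ℕ → Finset (D.H ≃ₐ[ℚ] D.H)) (ΓH ΓH' : ℕ → Subgroup (D.H ≃ₐ[ℚ] D.H))
    (σ : ℕ → (D.H ≃ₐ[ℚ] D.H)) (c : D.H ≃ₐ[ℚ] D.H) (hc : D.ConjSpec c)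
    (hblock : ∀ d ∈ n.divisors, ((d % 8 = 5 ∨ d % 8 = 6) → D.CMBlockSpec d (z d) (Φ d) (ΓH d) (ΓH' d) (σ d) c) ∧
      (d % 8 = 7 → D.SevenBlockSpec d))
    (hLl : Even (D.scriptL l))
    (hFrobl : ∃ φ : D.H ≃ₐ[ℚ] D.H, φ (D.sqrtNeg n) = D.sqrtNeg n ∧ φ * φ ∈ ΓH' n ∧ φ D.im = (jacobiSym (-1) l) • D.im ∧
      (∀ r : ℕ, r.Prime → r ∣ n → r ≠ l → φ (D.sqrtNeg r) = (jacobiSym (-(r : ℤ)) l) • D.sqrtNeg r) ∧ φ ∉ ΓH n)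
    {R : (congruentNumberCurve n).toAffine.Point}
    (hR : haveI := isElliptic_congruentNumberCurve hsq.ne_zero; ∀ P, ∃ k : ℤ, IsOfFinAddOrder (P - k • R))
    {Q₁ : APoint D.H} (hQ₁ : φH D Q₁ = Point.map (W' := curveA.twoIsogenyCodomain)
      (D.embK n (Nat.mem_divisors_self n hsq.ne_zero)) (ΘE hsq.ne_zero R))
    (g₀ : D.H ≃ₐ[ℚ] D.H) (hgi : g₀ D.im = D.im) (hg2 : g₀ (D.sqrtNeg 2) = D.sqrtNeg 2) (hgK : g₀ (D.sqrtNeg n) = D.sqrtNeg n)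
    (hmoveQ : D.galPt g₀ Q₁ ≠ Q₁) :
    (∀ L : ℤ, IsScriptL n L → (2 : ℤ) ∣ L ∧ ¬ (4 : ℤ) ∣ L) ↔ D.galPt g₀ (D.P n) ≠ D.P n := by
  haveI := isElliptic_congruentNumberCurve hsq.ne_zero
  have h6 : n % 8 = 6 := by
    rw [hn, mul_assoc, Nat.mul_mod, show (l * q) % 8 = q % 8 by rw [Nat.mul_mod, hl8, one_mul, Nat.mod_mod]]; omega
  have hsq0 := galPt_sq_genusPoint_eq_two_primes_even D hsq hl hq hlq hn hl8 hq4 hleg hrec z Φ ΓH ΓH' σ c hc hblock hLl hFrobl g₀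
  exact levelTwo_iff_galPt_genusPoint_ne_of_halfMover_of_sq_eq_even hGZK hsq h6 hr D h35 hLs h318 hR hQ₁ g₀ hgi hg2 hgK hmoveQ hsq0

/-- **THE LOWER HALF OF C⁺ ON THE EVEN TWO-PRIME JUMP-ONE CLASS, explicit form.**  `n = 2lq` square-free, `l ≡ 1 (mod 8)`, `q ≡ 3 (mod 4)`,
`(l/q) = 1` (⟺ `#Sel₂(E_n/ℚ) = 2⁵` on `n = 2lq ≡ 6 (mod 8)`: sectors E1/E2 of item 23431); `ord_{s=1} L(E_n, s) = 1`, GZK; the displays as above;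
`𝓛(l)` even (Thm 1.1); the Frobenius clause of `𝔭_l` with (F5); and a generator `R = (x, y)` of `E_n(ℚ)` modulo torsion with
`x ∉ {±1, ±2, ±n, ±2n}·ℚ^{×2}` (the `φ`-descent class of `R` is not in `⟨−1, 2, n⟩`).  Then **`𝓛(n)` is EVEN** (every sign choice) — the Ш-side
direction «Selmer excess ⟹ analytic Ш even» demanded by BSD₂ at `s = 3`; the even twin of g11's `HalfMover.two_dvd_scriptL_of_x_not_mem_of_card_selmer_odd`.
[cite: TianYuanZhang2017, Thm. 3.5 (p0011 L94–L100), Lemma 3.18, §3.1 (p0011 L1–L73), Prop. 3.2 (2), Thm. 3.6 (2), proof of Lemma 3.21 (p0020 L27–L63), Thm. 1.1, §1 (p0002 L101–L110)]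
[cite: Cox2013, §5.C Lemma 5.19, (5.22), Cor. 5.21, §9.A] [cite: SilvermanAEC2009, X.4.9] [cite: Darmon2004, Thm. 3.22] -/
theorem two_dvd_scriptL_two_primes_even_of_x_not_mem
    (hGZK : rank_eq_analyticRank_of_analyticRank_le_one) (hsq : Squarefree n) {l q : ℕ} (hl : l.Prime) (hq : q.Prime)
    (hlq : l ≠ q) (hn : n = 2 * l * q) (hl8 : l % 8 = 1) (hq4 : q % 4 = 3) (hleg : jacobiSym l q = 1)
    (hr : (congruentNumberCurve n).analyticRank = 1)
    (D : GenusPointData n) (hrec : D.recursion) (h35 : D.thm35Main) (hLs : D.scriptLSpec) (h318 : D.lemma318)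
    (z : ℕ → APoint D.H) (Φ : ℕ → Finset (D.H ≃ₐ[ℚ] D.H)) (ΓH ΓH' : ℕ → Subgroup (D.H ≃ₐ[ℚ] D.H))
    (σ : ℕ → (D.H ≃ₐ[ℚ] D.H)) (c : D.H ≃ₐ[ℚ] D.H) (hc : D.ConjSpec c)
    (hblock : ∀ d ∈ n.divisors, ((d % 8 = 5 ∨ d % 8 = 6) → D.CMBlockSpec d (z d) (Φ d) (ΓH d) (ΓH' d) (σ d) c) ∧
      (d % 8 = 7 → D.SevenBlockSpec d))
    (hLl : Even (D.scriptL l))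
    (hFrobl : ∃ φ : D.H ≃ₐ[ℚ] D.H, φ (D.sqrtNeg n) = D.sqrtNeg n ∧ φ * φ ∈ ΓH' n ∧ φ D.im = (jacobiSym (-1) l) • D.im ∧
      (∀ r : ℕ, r.Prime → r ∣ n → r ≠ l → φ (D.sqrtNeg r) = (jacobiSym (-(r : ℤ)) l) • D.sqrtNeg r) ∧ φ ∉ ΓH n)
    {x y : ℚ} (hxy : (congruentNumberCurve n).toAffine.Nonsingular x y)
    (hgen : haveI := isElliptic_congruentNumberCurve hsq.ne_zero;
      ∀ P, ∃ k : ℤ, IsOfFinAddOrder (P - k • (Point.some x y hxy : (congruentNumberCurve n).toAffine.Point)))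
    (hx : ¬ ∃ r : ℚ, x = r ^ 2 ∨ x = -r ^ 2 ∨ x = n * r ^ 2 ∨ x = -(n * r ^ 2))
    (hx2 : ¬ ∃ r : ℚ, x = 2 * r ^ 2 ∨ x = -(2 * r ^ 2) ∨ x = 2 * n * r ^ 2 ∨ x = -(2 * n * r ^ 2)) :
    ∀ L : ℤ, IsScriptL n L → (2 : ℤ) ∣ L := by
  haveI := isElliptic_congruentNumberCurve hsq.ne_zero
  have hnn : n ∈ n.divisors := Nat.mem_divisors_self n hsq.ne_zero
  obtain ⟨Q₁, hQ₁⟩ := twist_halving hsq hnn D (Point.some x y hxy)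
  obtain ⟨g₀, hgi, hg2, hgK, hmoveQ⟩ :=
    exists_halfMover_even_of_x_not_mem hsq ⟨l * q, by rw [hn]; ring⟩ D hxy hx hx2 hQ₁
  exact two_dvd_scriptL_two_primes_even_of_halfMover hGZK hsq hl hq hlq hn hl8 hq4 hleg hr D hrec h35 hLs h318 z Φ ΓH ΓH' σ c hc
    hblock hLl hFrobl hgen hQ₁ g₀ hgi hg2 hgK hmoveQ

end Summit.BirchSwinnertonDyer.PrintCf2.LowerHalfTwoPrimesEven

end
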